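import Summits.FinalStateConjecture.FinalStateConjecture.Theorems.EIHFluxBalanceInertialRecessionHoleTransport

/-!
# Route EIHFluxBalance — `InertialRecession`: the `C²` estimate of the transport defect

Helper file for the crux `stmt-FinalStateConjecture-10166`
(`Summit.FinalStateConjecture.FinalStateConjecture.Theses.EIHFluxBalance.InertialRecession`).

Continuation of `…HoleTransport`: the pointwise `C²` estimate of the transport defect
`G(y) = g_B(A y)[DA, DA] − g_{K∞}(y) = T + Σ_{j ≠ i} Hⱼ(A ·)[DA, DA]` of an `a = 0` hole chart at an
honestly placed model point, `‖Dᵐ G(y)‖ ≤ 16 C_K (2‖Λ∞⁻¹‖ + 5 + C_a)(4 + C_a) δ + N · 2¹⁰ η₂`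
(`m ≤ 2`), in terms of the painted kinematics `δ` at lab time `t = y⁰` (frame defect and model defect of
`…SMatrix`) and the `C²` size `η₂` of the other holes' fields at `A(y)` (`…Pullback` transport
estimate): `norm_iteratedFDeriv_transportDefect_le'` (registered form unprimed).
-/

noncomputable section

open scoped Topology ContDiff InnerProductSpace BigOperators Manifold
open Filter Set Metric Function TopologicalSpace Literature.Geometry.Lorentzian

namespace Summit.FinalStateConjecture.FinalStateConjecture.Theorems

section Estimate

variable {N : ℕ} (i : Fin N) (M : Fin N → ℝ) (ξ v : Fin N → ℝ → E3) (hv1 : ∀ j t, ‖v j t‖ < 1)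
  {V : E3} (hV : ‖V‖ < 1) {Ah : E4 → E4}
  (hAh : ∀ y : E4, Ah y = E4.ofTimeSpace (y 0) (ξ i (y 0) +
    (ContinuousLinearMap.id ℝ E3 - (Lorentz.gamma (v i (y 0)) / (Lorentz.gamma (v i (y 0)) + 1)) •
      (innerSL ℝ (v i (y 0))).smulRight (v i (y 0)))
      (E4.spatial ((Lorentz.boost V hV : E4 ≃L[ℝ] E4).symm y))))
  {H : Fin N → E4 → E4 →L[ℝ] E4 →L[ℝ] ℝ}
  (hH : ∀ j z, H j z = boostedKerrBilin (Lorentz.boost (v j (z 0)) (hv1 j (z 0)))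
    (E4.ofTimeSpace (z 0) (ξ j (z 0))) (M j) 0 z - Minkowski.bilin)
  {Bb : E4 → E4 →L[ℝ] E4 →L[ℝ] ℝ} (hBb : ∀ z, Bb z = Minkowski.bilin + ∑ j, H j z)
  (hξ : ∀ j, ContDiff ℝ ∞ (ξ j)) (hv : ∀ j, ContDiff ℝ ∞ (v j))

include hAh hH hBb hξ hv hv1 in
-- long chain of `C²` bookkeeping (frame defect, model defect, `N − 1` transported summands)
set_option maxHeartbeats 400000 in
/-- **`C²` estimate of the transport defect.** At a model point `x` with rest offset
`y̲ = (Λ∞⁻¹x)~`, `r₀ ≤ ‖y̲‖ ≤ R`, suppose the painted kinematics of hole `i` at lab time `t = x⁰` are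
`δ₀`-close to the frozen data (`ξᵢ' − V`, `ξᵢ''`, `ξᵢ'''`, `L − L_V`, `L'`, `L''`, `L'''`,
`a − a∞`, `a'`, `a''` all `≤ δ₀`, `‖a‖ ≤ C_a`, with `L(s) = L_{vᵢ(s)}`, `a(s) = boost(−vᵢ(s))`),
that `δ = (4 + R + 3‖Λ∞⁻¹‖) δ₀ ≤ 1`, and that every other painted summand is smooth near `A x` with
`C²` size `≤ η₂` there. Then for `m ≤ 2`,
`‖Dᵐ (g_B(A ·)[DA, DA] − g_{K∞})(x)‖ ≤ 16 C_K (2‖Λ∞⁻¹‖ + 5 + C_a)(4 + C_a) δ + N · 2¹⁰ η₂`, with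
`C_K` the `C²` bound of `g_{Mᵢ,0} ∘ Λ∞⁻¹` on `{‖(Λ∞⁻¹·)~‖ ≥ r₀}`. [folklore] -/
theorem norm_iteratedFDeriv_transportDefect_le' {r₀ : ℝ} (hr₀ : 0 < r₀) {x : E4} {R δ₀ Ca CK η₂ : ℝ}
    (hCa : 0 ≤ Ca) (hη₂ : 0 ≤ η₂)
    (hCK : ∀ y : E4, r₀ ≤ E4.spatialNorm ((((Lorentz.boost V hV : E4 ≃L[ℝ] E4).symm : E4 →L[ℝ] E4)) y) →
      ∀ l ≤ 2, ‖iteratedFDeriv ℝ l (fun z ↦ Kerr.bilin (M i) 0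
        ((((Lorentz.boost V hV : E4 ≃L[ℝ] E4).symm : E4 →L[ℝ] E4)) z)) y‖ ≤ CK)
    (hr : r₀ ≤ ‖E4.spatial ((Lorentz.boost V hV : E4 ≃L[ℝ] E4).symm x)‖)
    (hR : ‖E4.spatial ((Lorentz.boost V hV : E4 ≃L[ℝ] E4).symm x)‖ ≤ R) (hR0 : 0 ≤ R)
    (hδ0 : 0 ≤ δ₀)
    (hδ1 : (4 + R + 3 * ‖(((Lorentz.boost V hV : E4 ≃L[ℝ] E4).symm : E4 →L[ℝ] E4))‖) * δ₀ ≤ 1)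
    (hk1 : ‖deriv (ξ i) (x 0) - V‖ ≤ δ₀)
    (hk2 : ∀ l, 2 ≤ l → l ≤ 3 → ‖iteratedDeriv l (ξ i) (x 0)‖ ≤ δ₀)
    (hk3 : ∀ l, 1 ≤ l → l ≤ 3 → ‖iteratedDeriv l (fun s ↦ ContinuousLinearMap.id ℝ E3 -
      (Lorentz.gamma (v i s) / (Lorentz.gamma (v i s) + 1)) • (innerSL ℝ (v i s)).smulRight (v i s))
        (x 0)‖ ≤ δ₀)
    (hk4 : ‖(ContinuousLinearMap.id ℝ E3 - (Lorentz.gamma (v i (x 0)) / (Lorentz.gamma (v i (x 0)) + 1)) •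
        (innerSL ℝ (v i (x 0))).smulRight (v i (x 0))) - (ContinuousLinearMap.id ℝ E3 -
          (Lorentz.gamma V / (Lorentz.gamma V + 1)) • (innerSL ℝ V).smulRight V)‖ ≤ δ₀)
    (hk5 : ‖Lorentz.boostCLM (-v i (x 0)) - Lorentz.boostCLM (-V)‖ ≤ δ₀)
    (hk6 : ∀ l, 1 ≤ l → l ≤ 2 → ‖iteratedDeriv l (fun s ↦ Lorentz.boostCLM (-v i s)) (x 0)‖ ≤ δ₀)
    (hk7 : ‖Lorentz.boostCLM (-v i (x 0))‖ ≤ Ca)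
    (hoth : ∀ j ≠ i, 0 < E4.spatialNorm (Lorentz.boostCLM (-v j (Ah x 0))
        (Ah x - E4.ofTimeSpace (Ah x 0) (ξ j (Ah x 0)))) ∧
      ∀ l ≤ 2, ‖iteratedFDeriv ℝ l (H j) (Ah x)‖ ≤ η₂) :
    ∀ m ≤ 2, ‖iteratedFDeriv ℝ m (fun y ↦ (Bb (Ah y)).bilinearComp (fderiv ℝ Ah y) (fderiv ℝ Ah y) -
        boostedKerrBilin (Lorentz.boost V hV) 0 (M i) 0 y) x‖ ≤
      16 * CK * (2 * ‖(((Lorentz.boost V hV : E4 ≃L[ℝ] E4).symm : E4 →L[ℝ] E4))‖ + 5 + Ca) *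
        (4 + Ca) * ((4 + R + 3 * ‖(((Lorentz.boost V hV : E4 ≃L[ℝ] E4).symm : E4 →L[ℝ] E4))‖) * δ₀) +
      N * 2 ^ 10 * η₂ := by
  -- notation
  set Λi : E4 →L[ℝ] E4 := (((Lorentz.boost V hV : E4 ≃L[ℝ] E4).symm : E4 →L[ℝ] E4)) with hΛi
  set δ : ℝ := (4 + R + 3 * ‖Λi‖) * δ₀ with hδ
  set Lv : ℝ → E3 →L[ℝ] E3 := fun s ↦ ContinuousLinearMap.id ℝ E3 -
    (Lorentz.gamma (v i s) / (Lorentz.gamma (v i s) + 1)) • (innerSL ℝ (v i s)).smulRight (v i s)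
    with hLv
  set a : ℝ → E4 →L[ℝ] E4 := fun s ↦ Lorentz.boostCLM (-v i s) with ha
  have hΛia : Λi = Lorentz.boostCLM (-V) := by rw [hΛi]; exact coe_boost_symm' hV
  have hδ0' : 0 ≤ δ := by positivity
  -- smoothness of the data
  have hLvc : ContDiff ℝ ∞ Lv := by
    have hmaps : ∀ t, v i t ∈ ball (0 : E3) 1 := fun t ↦ by simpa using hv1 i t
    refine contDiff_iff_contDiffAt.mpr fun t ↦ ?_
    exact ((contDiffOn_restOffsetCLM (v i t) (hmaps t)).contDiffAt
      (isOpen_ball.mem_nhds (hmaps t))).comp t (hv i).contDiffAt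
  have hac : ContDiff ℝ ∞ a := contDiff_boostCLM_neg_comp (hv i) (hv1 i)
  have hAh' : ∀ y : E4, Ah y = E4.ofTimeSpace (y 0) (ξ i (y 0) +
      Lv (y 0) (E4.spatial ((Lorentz.boost V hV : E4 ≃L[ℝ] E4).symm y))) := fun y ↦ by
    rw [hAh y]
  have hAc : ContDiff ℝ ∞ Ah := contDiff_honestMap hV hAh' (hξ i) hLvc
  -- `‖DA − 1‖ ≤ δ` and `‖DʲA‖ ≤ δ` (`j = 2, 3`)
  have hDA : ‖fderiv ℝ Ah x - ContinuousLinearMap.id ℝ E4‖ ≤ δ := by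
    refine (norm_fderiv_honestMap_sub_id_le' hV hAh' (hξ i) hLvc x).trans ?_
    have h1 := hk3 1 le_rfl (by norm_num)
    rw [iteratedDeriv_one] at h1
    have h2 : ‖deriv Lv (x 0)‖ * ‖E4.spatial ((Lorentz.boost V hV : E4 ≃L[ℝ] E4).symm x)‖ ≤ δ₀ * R :=
      mul_le_mul h1 hR (norm_nonneg _) hδ0
    have h3 : ‖Lv (x 0) - (ContinuousLinearMap.id ℝ E3 - (Lorentz.gamma V / (Lorentz.gamma V + 1)) •
        (innerSL ℝ V).smulRight V)‖ * ‖Λi‖ ≤ δ₀ * ‖Λi‖ :=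
      mul_le_mul_of_nonneg_right hk4 (norm_nonneg _)
    rw [hδ]
    nlinarith [norm_nonneg Λi]
  have hDk : ∀ j, 2 ≤ j → j ≤ 3 → ‖iteratedFDeriv ℝ j Ah x‖ ≤ δ := by
    intro j hj2 hj3
    refine (norm_iteratedFDeriv_honestMap_le' hV hAh' (hξ i) hLvc x hj2).trans ?_
    have h1 := hk2 j hj2 hj3
    have h2 : ‖iteratedDeriv j Lv (x 0)‖ * ‖E4.spatial ((Lorentz.boost V hV : E4 ≃L[ℝ] E4).symm x)‖ ≤
        δ₀ * R := mul_le_mul (hk3 j (by omega) hj3) hR (norm_nonneg _) hδ0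
    have h3 : (j : ℝ) * ‖iteratedDeriv (j - 1) Lv (x 0)‖ * ‖Λi‖ ≤ 3 * δ₀ * ‖Λi‖ := by
      have hj' : (j : ℝ) ≤ 3 := by exact_mod_cast hj3
      have := hk3 (j - 1) (by omega) (by omega)
      exact mul_le_mul (mul_le_mul hj' this (norm_nonneg _) (by norm_num)) le_rfl (norm_nonneg _)
        (by positivity)
    rw [hδ]
    nlinarith [norm_nonneg Λi]
  have hD2 : ∀ j, 1 ≤ j → j ≤ 3 → ‖iteratedFDeriv ℝ j Ah x‖ ≤ 2 := by
    intro j hj1 hj3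
    rcases eq_or_lt_of_le hj1 with h | h
    · rw [← h, ← norm_iteratedFDeriv_fderiv, norm_iteratedFDeriv_zero]
      have := norm_add_le (fderiv ℝ Ah x - ContinuousLinearMap.id ℝ E4) (ContinuousLinearMap.id ℝ E4)
      rw [sub_add_cancel] at this
      linarith [ContinuousLinearMap.norm_id_le (𝕜 := ℝ) (E := E4), hδ1]
    · linarith [hDk j (by omega) hj3, hδ1]
  -- the frame defect
  set Ef : E4 → E4 →L[ℝ] E4 := fun y ↦ (a (y 0)).comp (fderiv ℝ Ah y) - Λi with hEf
  have hEc : ContDiff ℝ ∞ Ef := by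
    have h0 : ContDiff ℝ ∞ fun y : E4 ↦ y 0 := (EuclideanSpace.proj (0 : Fin 4) : E4 →L[ℝ] ℝ).contDiff
    exact ((hac.comp h0).clm_comp (hAc.fderiv_right (by simp))).sub contDiff_const
  have hEb : ∀ k ≤ 2, ‖iteratedFDeriv ℝ k Ef x‖ ≤ (4 + Ca) * δ := by
    have haV : ‖a (x 0) - Λi‖ ≤ δ := by
      rw [hΛia]
      refine hk5.trans ?_
      rw [hδ]; nlinarith [norm_nonneg Λi]
    have hak : ∀ l, 1 ≤ l → l ≤ 2 → ‖iteratedDeriv l a (x 0)‖ ≤ δ := fun l hl1 hl2 ↦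
      (hk6 l hl1 hl2).trans (by rw [hδ]; nlinarith [norm_nonneg Λi])
    exact norm_iteratedFDeriv_frameDefect_le' hac hAc Λi hδ0' hδ1 hCa hDA hDk hk7 haV hak
  -- the model defect
  set Kb : E4 → E4 →L[ℝ] E4 →L[ℝ] ℝ := fun y ↦ Kerr.bilin (M i) 0 (Λi y) with hKb
  set W : Set E4 := {y | r₀ / 2 < E4.spatialNorm (Λi y)} with hW
  have hWo : IsOpen W := by
    refine isOpen_lt continuous_const ?_
    unfold E4.spatialNorm
    fun_prop
  have hr' : r₀ ≤ E4.spatialNorm (Λi x) := by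
    rw [hΛi, E4.spatialNorm, ContinuousLinearEquiv.coe_coe]; exact hr
  have hxW : x ∈ W := by
    show r₀ / 2 < E4.spatialNorm (Λi x)
    linarith [half_lt_self hr₀]
  have hKc : ContDiffOn ℝ ∞ Kb W := by
    intro y hy
    have hrad : 0 < Kerr.radius 0 (Λi y) := by
      rw [Kerr.radius_zero_left]; exact (half_pos hr₀).trans hy
    exact ((Kerr.contDiffAt_bilin (M i) 0 hrad).comp y Λi.contDiff.contDiffAt).contDiffWithinAt
  have hδle : δ ≤ 1 := hδ1
  have hTb : ∀ m ≤ 2, ‖iteratedFDeriv ℝ m (fun y ↦ (Kb y).bilinearComp (Λi + Ef y) (Λi + Ef y) -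
      (Kb y).bilinearComp Λi Λi) x‖ ≤ 4 ^ m * CK * ((4 + Ca) * δ) * (2 * ‖Λi‖ + (4 + Ca)) := by
    intro m hm
    exact norm_iteratedFDeriv_modelDefect_le' (CK := CK) (ε := (4 + Ca) * δ) (CE := 4 + Ca) hWo hKc
      hEc Λi hxW m (fun l hl ↦ hCK x hr' l (hl.trans hm)) (fun l hl ↦ hEb l (hl.trans hm))
      (mul_le_of_le_one_right (by positivity) hδle)
  -- the other holes
  have hSj : ∀ j ≠ i, ∀ m ≤ 2, ‖iteratedFDeriv ℝ m (fun y ↦ (H j (Ah y)).bilinearComp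
      (fderiv ℝ Ah y) (fderiv ℝ Ah y)) x‖ ≤ 4 ^ m * m.factorial * η₂ * 2 ^ (m + 2) := by
    intro j hj m hm
    obtain ⟨hradj, hbj⟩ := hoth j hj
    have hΛjc : ContDiff ℝ ∞ (fun s ↦ (((Lorentz.boost (v j s) (hv1 j s) : E4 ≃L[ℝ] E4).symm :
        E4 →L[ℝ] E4))) :=
      contDiff_iff_contDiffAt.mpr fun s ↦
        (contDiff_boostCLM_neg_comp (hv j) (hv1 j)).contDiffAt.congr_of_eventuallyEq
          (Filter.Eventually.of_forall fun s ↦ coe_boost_symm' (hv1 j s))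
    have hWjo : IsOpen {z : E4 | 0 < E4.spatialNorm (Lorentz.boostCLM (-v j (z 0))
        (z - E4.ofTimeSpace (z 0) (ξ j (z 0))))} := by
      refine isOpen_lt continuous_const ?_
      have h0 : Continuous fun z : E4 ↦ z 0 := (EuclideanSpace.proj (0 : Fin 4) : E4 →L[ℝ] ℝ).continuous
      have hc : Continuous fun z : E4 ↦ Lorentz.boostCLM (-v j (z 0)) :=
        (contDiff_boostCLM_neg_comp (hv j) (hv1 j)).continuous.comp h0
      have hcc : Continuous fun s : ℝ ↦ E4.ofTimeSpace s (ξ j s) := by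
        have hsplit : (fun s ↦ E4.ofTimeSpace s (ξ j s)) =
            fun s : ℝ ↦ s • E4.basisVector 0 + E4.spaceEmbed (ξ j s) :=
          funext fun s ↦ E4.ofTimeSpace_eq_smul_add' s (ξ j s)
        rw [hsplit]
        exact (continuous_id.smul continuous_const).add
          (E4.spaceEmbed.continuous.comp (hξ j).continuous)
      have h1 := hc.clm_apply (continuous_id.sub (hcc.comp h0))
      unfold E4.spatialNorm
      fun_prop
    have hrad_of : ∀ z : E4, 0 < E4.spatialNorm (Lorentz.boostCLM (-v j (z 0))
        (z - E4.ofTimeSpace (z 0) (ξ j (z 0)))) →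
        0 < Kerr.radius 0 ((((Lorentz.boost (v j (z 0)) (hv1 j (z 0)) : E4 ≃L[ℝ] E4).symm :
          E4 →L[ℝ] E4)) (z - E4.ofTimeSpace (z 0) (ξ j (z 0)))) := by
      intro z hz
      rw [Kerr.radius_zero_left, coe_boost_symm' (hv1 j (z 0))]
      exact hz
    have hFjc : ContDiffOn ℝ ∞ (H j) {z : E4 | 0 < E4.spatialNorm (Lorentz.boostCLM (-v j (z 0))
        (z - E4.ofTimeSpace (z 0) (ξ j (z 0))))} := fun z hz ↦
      (contDiffAt_ansatzSummand (M := M j) (a := 0) hΛjc (hξ j) (hrad_of z hz)).contDiffWithinAt.congr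
        (fun y _ ↦ hH j y) (hH j z)
    exact norm_iteratedFDeriv_bilinearComp_fderiv_le' hWjo hFjc hAc (x := x) hradj m
      (fun l hl ↦ hbj l (hl.trans hm)) (fun l hl1 hl2 ↦ hD2 l hl1 (by omega)) (by norm_num)
  -- assemble
  intro m hm
  have hfun : (fun y ↦ (Bb (Ah y)).bilinearComp (fderiv ℝ Ah y) (fderiv ℝ Ah y) -
        boostedKerrBilin (Lorentz.boost V hV) 0 (M i) 0 y) =
      (fun y ↦ (Kb y).bilinearComp (Λi + Ef y) (Λi + Ef y) - (Kb y).bilinearComp Λi Λi) +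
        fun y ↦ ∑ j ∈ Finset.univ.erase i, (H j (Ah y)).bilinearComp (fderiv ℝ Ah y) (fderiv ℝ Ah y) := by
    funext y
    rw [transportDefect_eq i M ξ v hv1 hV hAh hH hBb y (fderiv ℝ Ah y)]
    simp only [Pi.add_apply, hEf, hKb, ha, hΛi, add_sub_cancel, ContinuousLinearEquiv.coe_coe]
  rw [hfun]
  have hTc : ContDiffAt ℝ m (fun y ↦ (Kb y).bilinearComp (Λi + Ef y) (Λi + Ef y) -
      (Kb y).bilinearComp Λi Λi) x := by
    have hKx : ContDiffAt ℝ ∞ Kb x := (hKc x hxW).contDiffAt (hWo.mem_nhds hxW)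
    have hLE : ContDiffAt ℝ ∞ (fun y ↦ Λi + Ef y) x := contDiffAt_const.add hEc.contDiffAt
    have h1 := contDiffWithinAt_bilinearComp_self (s := univ) hKx.contDiffWithinAt hLE.contDiffWithinAt
    have h2 := contDiffWithinAt_bilinearComp_self (s := univ) hKx.contDiffWithinAt
      (contDiffAt_const (c := Λi)).contDiffWithinAt
    exact ((h1.sub h2).contDiffAt univ_mem).of_le (by exact_mod_cast le_top)
  have hSc : ∀ j ∈ Finset.univ.erase i, ContDiffAt ℝ m (fun y ↦ (H j (Ah y)).bilinearComp
      (fderiv ℝ Ah y) (fderiv ℝ Ah y)) x := by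
    intro j hj
    have hj' : j ≠ i := Finset.ne_of_mem_erase hj
    obtain ⟨hradj, -⟩ := hoth j hj'
    have hΛjc : ContDiff ℝ ∞ (fun s ↦ (((Lorentz.boost (v j s) (hv1 j s) : E4 ≃L[ℝ] E4).symm :
        E4 →L[ℝ] E4))) :=
      contDiff_iff_contDiffAt.mpr fun s ↦
        (contDiff_boostCLM_neg_comp (hv j) (hv1 j)).contDiffAt.congr_of_eventuallyEq
          (Filter.Eventually.of_forall fun s ↦ coe_boost_symm' (hv1 j s))
    have hradj' : 0 < Kerr.radius 0 ((((Lorentz.boost (v j (Ah x 0)) (hv1 j (Ah x 0)) :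
        E4 ≃L[ℝ] E4).symm : E4 →L[ℝ] E4)) (Ah x - E4.ofTimeSpace (Ah x 0) (ξ j (Ah x 0)))) := by
      rw [Kerr.radius_zero_left, coe_boost_symm' (hv1 j (Ah x 0))]
      exact hradj
    have hF : ContDiffAt ℝ ∞ (H j) (Ah x) :=
      (contDiffAt_ansatzSummand (M := M j) (a := 0) hΛjc (hξ j) hradj').congr_of_eventuallyEq
        (Filter.Eventually.of_forall (hH j))
    have hFA := hF.comp x hAc.contDiffAt
    have hD : ContDiffAt ℝ ∞ (fderiv ℝ Ah) x := (hAc.fderiv_right (by simp)).contDiffAt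
    exact ((contDiffWithinAt_bilinearComp_self (s := univ) hFA.contDiffWithinAt
      hD.contDiffWithinAt).contDiffAt univ_mem).of_le (by exact_mod_cast le_top)
  rw [iteratedFDeriv_add_apply hTc (ContDiffAt.sum hSc), iteratedFDeriv_fun_sum_apply hSc]
  refine (norm_add_le _ _).trans (add_le_add ((hTb m hm).trans ?_) ((norm_sum_le _ _).trans ?_))
  · have h4 : (4 : ℝ) ^ m ≤ 16 := by
      interval_cases m <;> norm_num
    have hCK0 : 0 ≤ CK := (norm_nonneg _).trans (hCK x hr' 0 (Nat.zero_le _))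
    have hX : 0 ≤ CK * ((4 + Ca) * δ) * (2 * ‖Λi‖ + (4 + Ca)) := by positivity
    have hY : CK * ((4 + Ca) * δ) * (2 * ‖Λi‖ + (4 + Ca)) ≤
        CK * ((4 + Ca) * δ) * (2 * ‖Λi‖ + 5 + Ca) :=
      mul_le_mul_of_nonneg_left (by linarith) (by positivity)
    calc (4 : ℝ) ^ m * CK * ((4 + Ca) * δ) * (2 * ‖Λi‖ + (4 + Ca))
        = 4 ^ m * (CK * ((4 + Ca) * δ) * (2 * ‖Λi‖ + (4 + Ca))) := by ring
      _ ≤ 16 * (CK * ((4 + Ca) * δ) * (2 * ‖Λi‖ + 5 + Ca)) :=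
          mul_le_mul h4 hY hX (by norm_num)
      _ = 16 * CK * (2 * ‖Λi‖ + 5 + Ca) * (4 + Ca) * δ := by ring
  · have hcard : ((Finset.univ.erase i).card : ℝ) ≤ N := by
      rw [Finset.card_erase_of_mem (Finset.mem_univ i), Finset.card_univ, Fintype.card_fin]
      exact_mod_cast Nat.sub_le N 1
    have hterm : ∀ j ∈ Finset.univ.erase i, ‖iteratedFDeriv ℝ m (fun y ↦ (H j (Ah y)).bilinearComp
        (fderiv ℝ Ah y) (fderiv ℝ Ah y)) x‖ ≤ 2 ^ 10 * η₂ := by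
      intro j hj
      refine (hSj j (Finset.ne_of_mem_erase hj) m hm).trans ?_
      have h1 : (4 : ℝ) ^ m * m.factorial * 2 ^ (m + 2) ≤ 2 ^ 10 := by
        interval_cases m <;> norm_num [Nat.factorial]
      nlinarith
    calc ∑ j ∈ Finset.univ.erase i, ‖iteratedFDeriv ℝ m (fun y ↦ (H j (Ah y)).bilinearComp
          (fderiv ℝ Ah y) (fderiv ℝ Ah y)) x‖
        ≤ ∑ _j ∈ Finset.univ.erase i, 2 ^ 10 * η₂ := Finset.sum_le_sum hterm
      _ = (Finset.univ.erase i).card * (2 ^ 10 * η₂) := by rw [Finset.sum_const, nsmul_eq_mul]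
      _ ≤ N * (2 ^ 10 * η₂) := mul_le_mul_of_nonneg_right hcard (by positivity)
      _ = N * 2 ^ 10 * η₂ := by ring

/-! ### Registered form -/

-- long chain of `C²` bookkeeping (statement elaboration)
set_option maxHeartbeats 800000 in
/-- Registered sub-goal form (stub `norm_iteratedFDeriv_transportDefect_le` of the crux item) of
`norm_iteratedFDeriv_transportDefect_le'`. [folklore] -/
theorem norm_iteratedFDeriv_transportDefect_le : open Literature.Geometry.Lorentzian in ∀ {N : ℕ} (i : Fin N) (M : Fin N → ℝ) (ξ v : Fin N → ℝ → E3) (hv1 : ∀ j t, ‖v j t‖ < 1) {V : E3} (hV : ‖V‖ < 1) {Ah : E4 → E4}, (∀ y : E4, Ah y = E4.ofTimeSpace (y 0) (ξ i (y 0) + (ContinuousLinearMap.id ℝ E3 - (Lorentz.gamma (v i (y 0)) / (Lorentz.gamma (v i (y 0)) + 1)) • (innerSL ℝ (v i (y 0))).smulRight (v i (y 0))) (E4.spatial ((Lorentz.boost V hV : E4 ≃L[ℝ] E4).symm y)))) → ∀ {H : Fin N → E4 → E4 →L[ℝ] E4 →L[ℝ] ℝ}, (∀ j z, H j z = boostedKerrBilin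 (Lorentz.boost (v j (z 0)) (hv1 j (z 0))) (E4.ofTimeSpace (z 0) (ξ j (z 0))) (M j) 0 z - Minkowski.bilin) → ∀ {Bb : E4 → E4 →L[ℝ] E4 →L[ℝ] ℝ}, (∀ z, Bb z = Minkowski.bilin + ∑ j, H j z) → (∀ j, ContDiff ℝ ((⊤ : ℕ∞) : WithTop ℕ∞) (ξ j)) → (∀ j, ContDiff ℝ ((⊤ : ℕ∞) : WithTop ℕ∞) (v j)) → ∀ {r₀ : ℝ}, 0 < r₀ → ∀ {x : E4} {R δ₀ Ca CK η₂ : ℝ}, 0 ≤ Ca → 0 ≤ η₂ → (∀ y : E4, r₀ ≤ E4.spatialNorm ((((Lorentz.boost V hV : E4 ≃L[ℝ] E4).symm : E4 →L[ℝ] E4)) y) → ∀ l ≤ 2, ‖iteratedFDeriv ℝ l (fun z ↦ Kerr.bilin (M i) 0 ((((Lorentz.boost V hV : E4 ≃L[ℝ] E4).symm : E4 →L[ℝ] E4)) z)) y‖ ≤ CK) → r₀ ≤ ‖E4.spatial ((Lorentz.boost V hV : E4 ≃L[ℝ] E4).symm x)‖ → ‖E4.spatial ((Lorentz.boost V hV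 : E4 ≃L[ℝ] E4).symm x)‖ ≤ R → 0 ≤ R → 0 ≤ δ₀ → (4 + R + 3 * ‖(((Lorentz.boost V hV : E4 ≃L[ℝ] E4).symm : E4 →L[ℝ] E4))‖) * δ₀ ≤ 1 → ‖deriv (ξ i) (x 0) - V‖ ≤ δ₀ → (∀ l, 2 ≤ l → l ≤ 3 → ‖iteratedDeriv l (ξ i) (x 0)‖ ≤ δ₀) → (∀ l, 1 ≤ l → l ≤ 3 → ‖iteratedDeriv l (fun s ↦ ContinuousLinearMap.id ℝ E3 - (Lorentz.gamma (v i s) / (Lorentz.gamma (v i s) + 1)) • (innerSL ℝ (v i s)).smulRight (v i s)) (x 0)‖ ≤ δ₀) → ‖(ContinuousLinearMap.id ℝ E3 - (Lorentz.gamma (v i (x 0)) / (Lorentz.gamma (v i (x 0)) + 1)) • (innerSL ℝ (v i (x 0))).smulRight (v i (x 0))) - (ContinuousLinearMap.id ℝ E3 - (Lorentz.gamma V / (Lorentz.gamma V + 1)) • (innerSL ℝ V).smulRight V)‖ ≤ δ₀ → ‖Lorentz.boostCLM (-v i (x 0)) - Lorentz.boostCLM (-V)‖ ≤ δ₀ →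 (∀ l, 1 ≤ l → l ≤ 2 → ‖iteratedDeriv l (fun s ↦ Lorentz.boostCLM (-v i s)) (x 0)‖ ≤ δ₀) → ‖Lorentz.boostCLM (-v i (x 0))‖ ≤ Ca → (∀ j ≠ i, 0 < E4.spatialNorm (Lorentz.boostCLM (-v j (Ah x 0)) (Ah x - E4.ofTimeSpace (Ah x 0) (ξ j (Ah x 0)))) ∧ ∀ l ≤ 2, ‖iteratedFDeriv ℝ l (H j) (Ah x)‖ ≤ η₂) → ∀ m ≤ 2, ‖iteratedFDeriv ℝ m (fun y ↦ (Bb (Ah y)).bilinearComp (fderiv ℝ Ah y) (fderiv ℝ Ah y) - boostedKerrBilin (Lorentz.boost V hV) 0 (M i) 0 y) x‖ ≤ 16 * CK * (2 * ‖(((Lorentz.boost V hV : E4 ≃L[ℝ] E4).symm : E4 →L[ℝ] E4))‖ + 5 + Ca) * (4 + Ca) * ((4 + R + 3 * ‖(((Lorentz.boost V hV : E4 ≃L[ℝ] E4).symm : E4 →L[ℝ] E4))‖) * δ₀) + N * 2 ^ 10 * η₂ :=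
  fun i M ξ v hv1 _ hV _ hAh _ hH _ hBb hξ hv _ hr₀ _ _ _ _ _ _ hCa hη₂ hCK hr hR hR0 hδ0 hδ1 hk1 hk2 hk3 hk4 hk5 hk6 hk7 hoth ↦
    norm_iteratedFDeriv_transportDefect_le' i M ξ v hv1 hV hAh hH hBb hξ hv hr₀ hCa hη₂ hCK hr hR hR0 hδ0 hδ1 hk1 hk2
      hk3 hk4 hk5 hk6 hk7 hoth

end Estimate

end Summit.FinalStateConjecture.FinalStateConjecture.Theorems

end
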